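import Literature.Algebra.Homology.StupidFiltrationDegeneration
import Literature.Algebra.Homology.HyperExtSingle
import HarnessLib

/-!
# Vanishing of hyper-Ext above the amplitude from a TERMWISE bound (supports)

Let `C` be an abelian category with `HasExt.{w} C`, `A : C`, and `K : CochainComplex C ℤ` strictly
concentrated in degrees `[0, b]`. `Literature.Algebra.Homology.HyperExt` proves
`HyperExt A K k = 0` for `k > b + d` when `Extⁱ(A, -)` vanishes IDENTICALLY above `d`
(`HyperExt.eq_zero_of_hasProjectiveDimensionLE`, i.e. `A` of projective dimension `≤ d`; for
`A = ℤ` on a space: cohomological dimension `≤ d`). This file proves the same vanishing from the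
weaker, TERMWISE hypothesis `Extⁱ(A, Kʲ) = 0` for all `j` and all `i > d`
(`HyperExt.eq_zero_of_termwise`) — the form needed for complexes of sheaves supported on a closed
subset of dimension `d` of a bigger space (Grothendieck vanishing with supports bounds the terms,
not the site), e.g. X. Hu's complexes `p^{r,M}_{r,N}Ω•` on a `p`-adic scheme `𝒳/W(k)`, supported
on the special fibre (`Literature/AlgebraicGeometry/Crystalline/HuComplexes`).

Proof: induction along the stupid filtration `0 → Kⁿ¹[-n₁] → σ≤n₁ K → σ≤n₀ K → 0`
(`Literature.Algebra.Homology.StupidFiltration`, `shortExact_stupidFiltration`,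
`stupidFiltration_induction` of `…StupidFiltrationDegeneration`) and the long exact sequence of
hyper-Ext (`HyperExt.exact₂_apply`), the single columns being handled by the dictionary
`HyperExt A Y[-j] k ≃+ Ext^{k-j}(A, Y)` of `Literature.Algebra.Homology.HyperExtSingle`
(`HyperExt.singleEquiv`):

* `HyperExt.singleFunctor_obj_eq_zero_of_gt` — `HyperExt A Y[-j] k = 0` for `k > j + d` when
  `Extⁱ(A, Y) = 0` for all `i > d`;
* `HyperExt.stupidTruncLE_eq_zero_of_termwise`, `HyperExt.eq_zero_of_termwise` (main);
* the corollary `HyperExt.map_surjective_of_termwise`: in a short exact sequence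
  `0 → S.X₁ → S.X₂ → S.X₃ → 0` of complexes whose KERNEL `S.X₁` is strictly in `[0, b]` with terms
  of `Ext`-dimension `≤ d` over `A`, `HyperExt A S.X₂ k → HyperExt A S.X₃ k` is onto for every
  `k ≥ b + d` (the connecting map lands in `HyperExt A S.X₁ (k+1) = 0`).

Everything is proved; [folklore] homological algebra (C. A. Weibel, *An introduction to homological
algebra*, CUP 1994, 1.2.7–1.2.8 brutal truncations, 10.7 hyperext; the "dimension with supports"
use is R. Hartshorne, *Algebraic Geometry*, III.2.7 with III Ex. 2.3 / II Ex. 1.20).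
-/

universe w v u

open CategoryTheory Limits

namespace Literature.Algebra.Homology

namespace HyperExt

variable {C : Type u} [Category.{v} C] [Abelian C]

/-! ### Single columns -/

section Single

variable [HasExt.{w} C] {X : C} (Y : C)

/-- **Single-column vanishing above `j + d`**: if `Extⁱ(A, Y) = 0` for all `i > d` then
`HyperExt A Y[-j] k = 0` for all `k > j + d` (through `HyperExt.singleEquiv`:
`HyperExt A Y[-j] k ≃+ Ext^{k-j}(A, Y)`). [folklore] -/
theorem singleFunctor_obj_eq_zero_of_gt (d : ℕ)
    (hY : ∀ i : ℕ, d < i → ∀ y : Abelian.Ext.{w} X Y i, y = 0) (j k : ℤ) (hk : j + d < k)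
    [HasHyperExt.{w} X ((CochainComplex.singleFunctor C j).obj Y)]
    (x : HyperExt.{w} X ((CochainComplex.singleFunctor C j).obj Y) k) : x = 0 := by
  obtain ⟨n, hn⟩ := Int.eq_ofNat_of_zero_le (show (0 : ℤ) ≤ k - j by omega)
  rw [← (singleEquiv (X := X) Y j n k (by omega)).map_eq_zero_iff]
  exact hY n (by omega) _

end Single

/-! ### Vanishing above the amplitude from a termwise bound -/

section Termwise

variable [HasExt.{w} C] (A : C)
  [hA : ∀ (n : ℤ) (Y : C), HasHyperExt.{w} A ((CochainComplex.singleFunctor C n).obj Y)]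
  (K : CochainComplex C ℤ) [K.IsStrictlyGE 0]

/-- Termwise vanishing along the stupid filtration: if `Extⁱ(A, Kʲ) = 0` for all `j` and all
`i > d`, then `HyperExt A (σ≤n K) k = 0` for all `k > n + d`. [folklore] -/
theorem stupidTruncLE_eq_zero_of_termwise (d : ℕ)
    (hK : ∀ (j : ℤ) (i : ℕ), d < i → ∀ y : Abelian.Ext.{w} A (K.X j) i, y = 0) (n : ℤ) :
    ∀ (k : ℤ), n + d < k → ∀ x : HyperExt.{w} A (stupidTruncLE K n) k, x = 0 := by
  refine stupidFiltration_induction (P := fun n => ∀ (k : ℤ), n + d < k →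
    ∀ x : HyperExt.{w} A (stupidTruncLE K n) k, x = 0) ?_ ?_ n
  · intro n hn k _ x
    exact hyperExt_stupidTruncLE_eq_zero_of_neg A K n hn k x
  · intro n₀ n₁ h ih k hk x
    have hx : map (X := A) (stupidTruncLEMapOfLE K n₀ n₁ (by omega)) k x = 0 :=
      ih k (by omega) _
    obtain ⟨y, rfl⟩ := (exact_map_singleToStupidTruncLE A K n₀ n₁ h k x).mp hx
    rw [singleFunctor_obj_eq_zero_of_gt (X := A) (K.X n₁) d (hK n₁) n₁ k (by omega) y, map_zero]

/-- **Vanishing of hyper-Ext above amplitude plus termwise `Ext`-dimension.** Let `K` be strictly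
concentrated in degrees `[0, b]` and suppose `Extⁱ(A, Kʲ) = 0` for every term `Kʲ` and every
`i > d` (e.g. `A = ℤ` and the `Kʲ` abelian sheaves supported on a closed subset of dimension `≤ d`
of a noetherian space: Grothendieck vanishing with supports). Then `HyperExt A K k = 0` for every
`k > b + d`. (The global-dimension form is `HyperExt.eq_zero_of_hasProjectiveDimensionLE`.)
[folklore] -/
theorem eq_zero_of_termwise (b : ℤ) [K.IsStrictlyLE b] (d : ℕ)
    (hK : ∀ (j : ℤ) (i : ℕ), d < i → ∀ y : Abelian.Ext.{w} A (K.X j) i, y = 0)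
    [HasHyperExt.{w} A K] {k : ℤ} (hk : b + d < k) (x : HyperExt.{w} A K k) : x = 0 := by
  apply (map_stupidTruncLEπ_bijective A K b k).1
  rw [map_zero]
  exact stupidTruncLE_eq_zero_of_termwise A K d hK b k hk _

/-- **Surjectivity from a small kernel.** Let `0 → S.X₁ → S.X₂ → S.X₃ → 0` be a short exact
sequence of cochain complexes whose kernel `S.X₁` is strictly concentrated in degrees `[0, b]`
with `Extⁱ(A, S.X₁ʲ) = 0` for all `j` and all `i > d`. Then
`HyperExt A S.X₂ k → HyperExt A S.X₃ k` is surjective for every `k ≥ b + d` (its cokernel embeds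
into `HyperExt A S.X₁ (k + 1) = 0`, `eq_zero_of_termwise`). [folklore] -/
theorem map_surjective_of_termwise {S : ShortComplex (CochainComplex C ℤ)} (hS : S.ShortExact)
    [S.X₁.IsStrictlyGE 0] (b : ℤ) [S.X₁.IsStrictlyLE b] (d : ℕ)
    (h₁ : ∀ (j : ℤ) (i : ℕ), d < i → ∀ y : Abelian.Ext.{w} A (S.X₁.X j) i, y = 0)
    [HasHyperExt.{w} A S.X₁] [HasHyperExt.{w} A S.X₂] [HasHyperExt.{w} A S.X₃]
    {k : ℤ} (hk : b + d ≤ k) : Function.Surjective (map (X := A) S.g k) := fun y =>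
  ((exact₃_apply A hS k (k + 1) rfl) y).mp
    (eq_zero_of_termwise A S.X₁ b d h₁ (by omega) _)

end Termwise

end HyperExt

end Literature.Algebra.Homology
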